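import Summits.QuantumFields.BalabanUV.T4Continuum.Support.TermwiseHolderThm1

/-!
# SUBSTRATE — FAITHFUL REGULARITY FIELDS FOR `B11.VarProblem` IN THE HÖLDER CURRENCY: gauge representations on an `l¹`-ball,
# the common-factor feasibility `RegWithin`, its infimum `gaugeSize`, the witnessed predicate `GaugedAt`, and NE7's `HolderReg` ∕
# `Realises.gauge` clauses BY CONSTRUCTION ([dict] S-VOC-2 part 2, re-scoped; located typing remark R-SUB-p2-1, journal l.15234)

Cell `pub-balaban`, SUBSTRATE cell, seat `b2b-balaban-substrate-p2` (gen 2).  Summits-side under the LEAN PLACEMENT RULE.  HONEST FRAMING: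
rung (B)+1 of the FINITE-VOLUME T⁴ programme — NOT infinite volume, NOT a mass gap, NOT Clay; spine PROVED 0∕9; NE3 ∕ NE7 NOT proved; B11
Theorem 1 is asserted NOWHERE (it stays the rows' displayed hypothesis `B11Thm1.Thm1At`).  This file is BOOKKEEPING ONLY and AVERAGING-AGNOSTIC
(it mentions neither B7 (42) nor [Balaban1987RG1] (0.4)): no estimate, no cite tag on an asserted printed statement.
HONEST DEPENDENCY (cell line, verbatim): continuum YM on T⁴ ⇐ BetaPertH ∧ nine spine estimates (0/9 proved); BetaPertH ⇐ (D1) ∧ (D4) ∧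
CAP+tail; G-an2-4 gates asym, D1 and NE2/3/4.

WHY.  Row NE7's term-wise END (`TermwiseLocal.goodClause_summable_UN_levels_of_thm1At(_coarse)`) consumes two `B11.VarProblem` families
`famA famB` through `TermwiseHolder.Realises P d 𝔸`, whose `gauge` field turns the carrier's regularity fields `normA`, `normGradA`,
`holderA` into OBLIGATIONS on a realising gauge `(u, B)`: `‖B‖ ≤ η·normA`, `‖ΔB‖ ≤ η²·normGradA`, and the first differences of `B`
`(η²·holderA U □ β, β)`-Hölder on the ball (B11HolderComplex `HolderOn`).  Row NE3's instance `MinimalActionDictionary.torusVP` sets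
`holderA := 0` (its divergence D-s3-4 — harmless for NE3, where `holderA` is only bounded above), so `Realises (torusVP …)` would demand Hölder
constant `0` (affine potentials) at every `Gauged` cube: the joint «famA := torusVP» presumed by the substrate MAP v0.5 §3 (row NE7 NODE O.3) is
not inhabitable in a useful way (R-SUB-p2-1).  This module supplies regularity fields that ARE faithful in NE7's currency, for ANY configuration
reading `V : Site d → Fin d → 𝔸ˣ` (so for (42)-problems and (0.4)-problems alike):

* §1 `IsGaugeRep V z R u B` — `u` is `U1`-valued and `V = gaugeAct u (expUnit ∘ B)` on the `l¹`-ball `{x | l1 (x − z) ≤ R}` (the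
  representation clause of `HolderReg` ∕ `Realises.gauge`, verbatim); `RegWithin z R η s B t` — the THREE bound clauses of `HolderReg` with
  constants `(c₀, c₁, c₂) = (s·t, s²·t, s^{2+β}·t)` for EVERY `β ∈ [0,1]` at once: ONE common factor `t` (row NE3's faithful-existential device,
  `MinimalActionDictionary` §3, extended by the Hölder clause), `s` the cube's scale factor `(L^j η)⁻¹` of [Balaban1985Variational] (9)–(10) so
  that `|A| < B₃Mε₁ s`, `|∇A| < B₃Mε₁ s²`, `‖A‖_{1,β} < B₄Mε₁ s^{2+β}`, `|ΔA| < B₃Mε₁ s³` all read «`t < const·M·ε₁`».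
* §2 `feasible V z R η s = {t ≥ 0 | ∃ u B, IsGaugeRep ∧ RegWithin … t}` (upward closed for `η, s ≥ 0`), `gaugeSize := sInf feasible`
  (`≥ 0`, `≤` every feasible `t`), `GaugedAt := gaugeSize ∈ feasible` (the infimum is WITNESSED — the form `Realises.gauge` needs; that a
  witness exists as soon as any representation does is the compactness lemma of the follower `SubstrateGaugeSizeAttained`).
* §3 the dictionary to NE7's currency: `holderReg_of_feasible`, **`holderReg_of_gaugedAt`** (`HolderReg V z R η (s·g) (s²·g) β (s^{2+β}·g)`,
  `g = gaugeSize`, every `β ∈ [0,1]`) and **`realisesGauge_of_gaugedAt`** = the body of `Realises.gauge` for a carrier whose fields are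
  `Gauged U □ := GaugedAt (cfg U) (centre □) (radius □) η (s □)`, `normA := s·g`, `normGradA := s²·g`, `holderA β := s^{2+β}·g` (`normLapA := s³·g`
  is read by nobody through `Realises`; the follower `SubstrateVarProblemOfRecord` takes it so, with the divergence noted there).
* §4 non-vacuity: the constant configuration `1` is represented by `(u, B) = (1, 0)` with `t = 0`: `gaugeSize 1 … = 0`, `GaugedAt 1 …`.
-/

noncomputable section

open scoped BigOperators

namespace Summit.QuantumFields.BalabanUV.T4Continuum.SubstrateGaugeSize

open Literature.MathematicalPhysics.QuantumFieldTheory.Balaban1983to89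
open B7Prop1Explicit B11HolderComplex
open TermwiseHolder (HolderReg)

variable {d : ℕ} {𝔸 : Type*} [NormedRing 𝔸] [NormOneClass 𝔸] [NormedAlgebra ℂ 𝔸] [CompleteSpace 𝔸]

/-! ## §1 Gauge representations on a ball and the common-factor feasibility -/

/-- **A LOCAL GAUGE REPRESENTATION** of the configuration `V` on the `l¹`-ball of radius `R` about `z`: norm-bounded gauge units
`u` (`U1`) and an algebra-valued potential `B` (`= ηA`) with `V(x,κ) = u(x)·e^{B(x,κ)}·u(x+e_κ)⁻¹` for `l1 (x − z) ≤ R` — the first two clauses of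
`TermwiseHolder.HolderReg` ∕ `Realises.gauge`, verbatim («there exists a gauge transformation u defined on a neighborhood of □ and such that on □,
U^{u⁻¹} = e^{iηA}», [Balaban1985Variational] Thm 1 p. 279 — the SHAPE only). [folklore] -/
def IsGaugeRep (V : Site d → Fin d → 𝔸ˣ) (z : Site d) (R : ℕ) (u : Site d → 𝔸ˣ) (B : Site d → Fin d → 𝔸) : Prop :=
  (∀ x, u x ∈ U1 𝔸) ∧ ∀ x κ, l1 (x - z) ≤ R → V x κ = gaugeAct u (fun y ι => expUnit (B y ι)) x κ

/-- **THE COMMON-FACTOR FEASIBILITY** of a potential `B` on the ball, spacing `η`, scale factor `s`, factor `t`: the three bound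
clauses of `HolderReg` with `(c₀, c₁, c₂) = (s·t, s²·t, s^{2+β}·t)` — `‖B‖ ≤ η·(s·t)` (*"|A|"*), `‖B(x+e_ι,κ) − B(x,κ)‖ ≤ η²·(s²·t)` (*"|∇^ηA|"*),
and for EVERY `0 ≤ β ≤ 1` the family of first differences `(η²·(s^{2+β}·t), β)`-Hölder over the pairs of the ball at physical distance
`η·|x′ − x|₁ ≤ 1` (*"‖A‖_{1,β}"*). [folklore] -/
def RegWithin (z : Site d) (R : ℕ) (η s : ℝ) (B : Site d → Fin d → 𝔸) (t : ℝ) : Prop :=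
  (∀ x κ, l1 (x - z) ≤ R → ‖B x κ‖ ≤ η * (s * t)) ∧
  (∀ x κ ι, l1 (x - z) ≤ R → ‖B (x + e ι) κ - B x κ‖ ≤ η ^ 2 * (s ^ 2 * t)) ∧
  (∀ β : ℝ, 0 ≤ β → β ≤ 1 →
    HolderOn (fun x x' => η * (l1 (x' - x) : ℝ)) β
      (fun x x' => (l1 (x - z) ≤ R ∧ l1 (x' - z) ≤ R) ∧ η * (l1 (x' - x) : ℝ) ≤ 1)
      (fun x (p : Fin d × Fin d) => B (x + e p.1) p.2 - B x p.2) (η ^ 2 * (s ^ (2 + β) * t)))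

omit [NormOneClass 𝔸] [NormedAlgebra ℂ 𝔸] [CompleteSpace 𝔸] in
/-- Feasibility is monotone in the factor (`η, s ≥ 0`). [folklore] -/
theorem RegWithin.mono {z : Site d} {R : ℕ} {η s : ℝ} {B : Site d → Fin d → 𝔸} {t t' : ℝ} (h : RegWithin z R η s B t)
    (hη : 0 ≤ η) (hs : 0 ≤ s) (htt' : t ≤ t') : RegWithin z R η s B t' := by
  obtain ⟨h₀, h₁, h₂⟩ := h
  refine ⟨fun x κ hx => (h₀ x κ hx).trans ?_, fun x κ ι hx => (h₁ x κ ι hx).trans ?_, fun β hβ0 hβ1 => ?_⟩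
  · exact mul_le_mul_of_nonneg_left (mul_le_mul_of_nonneg_left htt' hs) hη
  · exact mul_le_mul_of_nonneg_left (mul_le_mul_of_nonneg_left htt' (sq_nonneg s)) (sq_nonneg η)
  · exact (h₂ β hβ0 hβ1).mono (fun x x' => by positivity)
      (mul_le_mul_of_nonneg_left (mul_le_mul_of_nonneg_left htt' (Real.rpow_nonneg hs _)) (sq_nonneg η))

/-! ## §2 The feasible factors, their infimum, the witnessed predicate -/

/-- **THE FEASIBLE FACTORS** of `V` on the ball: `t ≥ 0` for which SOME local gauge representation has all three bounds with the
common factor `t`. [folklore] -/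
def feasible (V : Site d → Fin d → 𝔸ˣ) (z : Site d) (R : ℕ) (η s : ℝ) : Set ℝ :=
  {t | 0 ≤ t ∧ ∃ (u : Site d → 𝔸ˣ) (B : Site d → Fin d → 𝔸), IsGaugeRep V z R u B ∧ RegWithin z R η s B t}

/-- **THE GAUGE SIZE** `g(V; z, R, η, s) := inf feasible` — the least common factor (a real infimum; `0` on an empty set by
Mathlib's convention, a case excluded wherever it matters by `GaugedAt`). [folklore] -/
def gaugeSize (V : Site d → Fin d → 𝔸ˣ) (z : Site d) (R : ℕ) (η s : ℝ) : ℝ :=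
  sInf (feasible V z R η s)

/-- **GAUGED (witnessed form)**: the infimum is itself feasible — there IS a local gauge representation with all three bounds at
the common factor `gaugeSize`.  (That this follows from the existence of any representation is the compactness lemma of the follower module.) [folklore] -/
def GaugedAt (V : Site d → Fin d → 𝔸ˣ) (z : Site d) (R : ℕ) (η s : ℝ) : Prop :=
  gaugeSize V z R η s ∈ feasible V z R η s

/-- Unfolding of membership in `feasible`. [folklore] -/
theorem mem_feasible_iff {V : Site d → Fin d → 𝔸ˣ} {z : Site d} {R : ℕ} {η s t : ℝ} :
    t ∈ feasible V z R η s ↔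
      0 ≤ t ∧ ∃ (u : Site d → 𝔸ˣ) (B : Site d → Fin d → 𝔸), IsGaugeRep V z R u B ∧ RegWithin z R η s B t :=
  Iff.rfl

/-- The feasible set is bounded below by `0`. [folklore] -/
theorem feasible_bddBelow (V : Site d → Fin d → 𝔸ˣ) (z : Site d) (R : ℕ) (η s : ℝ) : BddBelow (feasible V z R η s) :=
  ⟨0, fun _ ht => ht.1⟩

/-- The feasible set is upward closed (`η, s ≥ 0`). [folklore] -/
theorem feasible_upward {V : Site d → Fin d → 𝔸ˣ} {z : Site d} {R : ℕ} {η s t t' : ℝ} (ht : t ∈ feasible V z R η s)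
    (hη : 0 ≤ η) (hs : 0 ≤ s) (htt' : t ≤ t') : t' ∈ feasible V z R η s := by
  obtain ⟨ht0, u, B, hrep, hreg⟩ := ht
  exact ⟨ht0.trans htt', u, B, hrep, hreg.mono hη hs htt'⟩

/-- `0 ≤ gaugeSize`. [folklore] -/
theorem gaugeSize_nonneg (V : Site d → Fin d → 𝔸ˣ) (z : Site d) (R : ℕ) (η s : ℝ) : 0 ≤ gaugeSize V z R η s :=
  Real.sInf_nonneg fun _ ht => ht.1

/-- `gaugeSize ≤ t` for every feasible `t`. [folklore] -/
theorem gaugeSize_le {V : Site d → Fin d → 𝔸ˣ} {z : Site d} {R : ℕ} {η s t : ℝ} (ht : t ∈ feasible V z R η s) :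
    gaugeSize V z R η s ≤ t :=
  csInf_le (feasible_bddBelow V z R η s) ht

/-- Below any strict upper bound of `gaugeSize` there is a feasible factor (nonempty feasible set). [folklore] -/
theorem exists_feasible_lt {V : Site d → Fin d → 𝔸ˣ} {z : Site d} {R : ℕ} {η s b : ℝ} (hne : (feasible V z R η s).Nonempty)
    (hb : gaugeSize V z R η s < b) : ∃ t ∈ feasible V z R η s, t < b :=
  exists_lt_of_csInf_lt hne hb

/-- If `0` is feasible the gauge size is `0` and is witnessed. [folklore] -/
theorem gaugeSize_eq_zero_of_zero_mem {V : Site d → Fin d → 𝔸ˣ} {z : Site d} {R : ℕ} {η s : ℝ} (h0 : (0 : ℝ) ∈ feasible V z R η s) :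
    gaugeSize V z R η s = 0 :=
  le_antisymm (gaugeSize_le h0) (gaugeSize_nonneg V z R η s)

/-- If `0` is feasible the configuration is `GaugedAt` the ball. [folklore] -/
theorem gaugedAt_of_zero_mem {V : Site d → Fin d → 𝔸ˣ} {z : Site d} {R : ℕ} {η s : ℝ} (h0 : (0 : ℝ) ∈ feasible V z R η s) :
    GaugedAt V z R η s := by
  unfold GaugedAt
  rwa [gaugeSize_eq_zero_of_zero_mem h0]

/-- A witnessed minimum: if `t` is feasible and no smaller factor is, then `gaugeSize = t` and `GaugedAt`. [folklore] -/
theorem gaugedAt_of_isLeast {V : Site d → Fin d → 𝔸ˣ} {z : Site d} {R : ℕ} {η s t : ℝ} (h : IsLeast (feasible V z R η s) t) :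
    gaugeSize V z R η s = t ∧ GaugedAt V z R η s := by
  have heq : gaugeSize V z R η s = t := h.csInf_eq
  exact ⟨heq, by unfold GaugedAt; rw [heq]; exact h.1⟩

/-! ## §3 The dictionary to row NE7's currency: `HolderReg` and the `Realises.gauge` clause -/

/-- **A feasible factor gives `HolderReg` with constants `(s·t, s²·t, s^{2+β}·t)`**, every `β ∈ [0,1]` (the clauses are literally
`HolderReg`'s). [folklore] -/
theorem holderReg_of_feasible {V : Site d → Fin d → 𝔸ˣ} {z : Site d} {R : ℕ} {η s t : ℝ} (ht : t ∈ feasible V z R η s) {β : ℝ}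
    (hβ0 : 0 ≤ β) (hβ1 : β ≤ 1) : HolderReg V z R η (s * t) (s ^ 2 * t) β (s ^ (2 + β) * t) := by
  obtain ⟨-, u, B, ⟨hu, hrep⟩, h₀, h₁, h₂⟩ := ht
  exact ⟨u, B, hu, hrep, h₀, h₁, h₂ β hβ0 hβ1⟩

/-- **`GaugedAt` ⇒ `HolderReg V z R η (s·g) (s²·g) β (s^{2+β}·g)`**, `g = gaugeSize`, for every `β ∈ [0,1]` — row NE7's regularity
binder in the printed Hölder currency BY NAME, at the least common factor. [folklore] -/
theorem holderReg_of_gaugedAt {V : Site d → Fin d → 𝔸ˣ} {z : Site d} {R : ℕ} {η s : ℝ} (h : GaugedAt V z R η s) {β : ℝ}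
    (hβ0 : 0 ≤ β) (hβ1 : β ≤ 1) :
    HolderReg V z R η (s * gaugeSize V z R η s) (s ^ 2 * gaugeSize V z R η s) β (s ^ (2 + β) * gaugeSize V z R η s) :=
  holderReg_of_feasible h hβ0 hβ1

/-- **THE BODY OF `Realises.gauge` BY CONSTRUCTION.**  For a carrier whose regularity fields at the cube `□` are
`Gauged U □ := GaugedAt (cfg U) (centre □) (radius □) η (s □)`, `normA U □ := s □ · g`, `normGradA U □ := (s □)² · g`,
`holderA U □ β := (s □)^{2+β} · g` (`g` the gauge size of `cfg U` there), the `gauge` field of `TermwiseHolder.Realises` is this statement with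
`V := cfg U`, `z := centre □`, `R := radius □`, `s := s □`. [folklore] -/
theorem realisesGauge_of_gaugedAt {V : Site d → Fin d → 𝔸ˣ} {z : Site d} {R : ℕ} {η s : ℝ} (h : GaugedAt V z R η s) :
    ∃ (u : Site d → 𝔸ˣ) (B : Site d → Fin d → 𝔸),
      (∀ x, u x ∈ U1 𝔸) ∧
      (∀ x κ, l1 (x - z) ≤ R → V x κ = gaugeAct u (fun y ι => expUnit (B y ι)) x κ) ∧
      (∀ x κ, l1 (x - z) ≤ R → ‖B x κ‖ ≤ η * (s * gaugeSize V z R η s)) ∧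
      (∀ x κ ι, l1 (x - z) ≤ R → ‖B (x + e ι) κ - B x κ‖ ≤ η ^ 2 * (s ^ 2 * gaugeSize V z R η s)) ∧
      (∀ β : ℝ, 0 ≤ β → β ≤ 1 →
        HolderOn (fun x x' => η * (l1 (x' - x) : ℝ)) β
          (fun x x' => (l1 (x - z) ≤ R ∧ l1 (x' - z) ≤ R) ∧ η * (l1 (x' - x) : ℝ) ≤ 1)
          (fun x (p : Fin d × Fin d) => B (x + e p.1) p.2 - B x p.2) (η ^ 2 * (s ^ (2 + β) * gaugeSize V z R η s))) := by
  obtain ⟨-, u, B, ⟨hu, hrep⟩, h₀, h₁, h₂⟩ := h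
  exact ⟨u, B, hu, hrep, h₀, h₁, h₂⟩

/-- **THE (9)–(10) ARITHMETIC at a cube of scale factor `s > 0`**: with the fields `s·g`, `s²·g`, `s^{2+β}·g`, `s³·g` the four
printed bounds `… < C·M·ε₁·s^{(1,2,2+β,3)}` read `g < C·M·ε₁` (for the three integer powers) — the common-factor device makes [Balaban1985Variational]
(9)–(10) ONE inequality on the factor. [folklore] -/
theorem scaled_lt_iff {s g c : ℝ} (hs : 0 < s) (n : ℕ) : s ^ n * g < c * s ^ n ↔ g < c := by
  rw [mul_comm c, mul_lt_mul_iff_of_pos_left (pow_pos hs n)]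

/-- The same for the real power `2 + β` of the Hölder clause. [folklore] -/
theorem scaled_rpow_lt_iff {s g c β : ℝ} (hs : 0 < s) : s ^ (2 + β) * g < c * s ^ (2 + β) ↔ g < c := by
  rw [mul_comm c, mul_lt_mul_iff_of_pos_left (Real.rpow_pos_of_pos hs _)]

/-! ## §4 Non-vacuity: the constant configuration -/

/-- `(u, B) = (1, 0)` represents the constant configuration `1` on every ball. [folklore] -/
theorem isGaugeRep_one (z : Site d) (R : ℕ) :
    IsGaugeRep (fun (_ : Site d) (_ : Fin d) => (1 : 𝔸ˣ)) z R (fun _ => 1) (fun _ _ => 0) := by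
  have h0 : expUnit (0 : 𝔸) = 1 := Units.ext (by simp [expUnit])
  exact ⟨fun _ => Subgroup.one_mem _, fun x κ _ => by simp [gaugeAct, h0]⟩

omit [NormOneClass 𝔸] [NormedAlgebra ℂ 𝔸] [CompleteSpace 𝔸] in
/-- The zero potential is feasible with factor `0`. [folklore] -/
theorem regWithin_zero (z : Site d) (R : ℕ) (η s : ℝ) : RegWithin z R η s (fun (_ : Site d) (_ : Fin d) => (0 : 𝔸)) 0 := by
  refine ⟨fun x κ _ => by simp, fun x κ ι _ => by simp, fun β _ _ => ?_⟩
  intro x x' _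
  simp

/-- `0` is a feasible factor of the constant configuration `1`. [folklore] -/
theorem zero_mem_feasible_one (z : Site d) (R : ℕ) (η s : ℝ) :
    (0 : ℝ) ∈ feasible (fun (_ : Site d) (_ : Fin d) => (1 : 𝔸ˣ)) z R η s :=
  ⟨le_rfl, fun _ => 1, fun _ _ => 0, isGaugeRep_one z R, regWithin_zero z R η s⟩

/-- **NON-VACUITY**: the constant configuration has gauge size `0` … [folklore] -/
theorem gaugeSize_one (z : Site d) (R : ℕ) (η s : ℝ) : gaugeSize (fun (_ : Site d) (_ : Fin d) => (1 : 𝔸ˣ)) z R η s = 0 :=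
  gaugeSize_eq_zero_of_zero_mem (zero_mem_feasible_one z R η s)

/-- … and is `GaugedAt` every ball, spacing and scale factor. [folklore] -/
theorem gaugedAt_one (z : Site d) (R : ℕ) (η s : ℝ) : GaugedAt (fun (_ : Site d) (_ : Fin d) => (1 : 𝔸ˣ)) z R η s :=
  gaugedAt_of_zero_mem (zero_mem_feasible_one z R η s)

end Summit.QuantumFields.BalabanUV.T4Continuum.SubstrateGaugeSize

end
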